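import Literature.AnabelianGeometry.EtaleTheta.GalSectThm110iiiDeltaCTransport
import HarnessLib

/-!
# [EtTh] Thm. 1.10 (iii) — ONE closer with the fully X-LEVEL residual (proof-only)

Mochizuki, *The étale theta function …* [EtTh], Publ. RIMS **45** (2009), Thm. 1.10 (iii) p.256
[cite: MochizukiEtTh2009, Thm 1.10 (iii) p.30].  abc-iut cell, layer L2, seat abc-iut-w5-d062 (gen 3); the knit of
p435878 (END-KNIT) + p438817 ((b1) from the X-level) + p441939 ((Δ) from the X-level).  PROOF-ONLY.

`thm110iiiGalSect_of_Xlevel` : the typed `Thm110iiiGalSect H Sα Sβ Cα Cβ` from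
* (law) the Def. 4.1 (iii) law of the canonical integral structure (v-next field);
* topological side conditions at the two cusp pairs (v-next fields) and `Π^tp_C` T1;
* (x) the X-level cusp decomposition transport `γ_X(g_α·D_{x_α}·g_α⁻¹) = σ·(g_β·D_{x_β}·g_β⁻¹)·σ⁻¹`, `σ ∈ Π^tp_{Ċβ}`
  ([SemiAnbd] Thm. 6.5 (iii) read at the orbicurve `Ċ`);
* (ct) commensurable terminality of the two cusp decomposition groups in `Π^tp_Ċ` ([SemiAnbd] Thm. 6.5 (ii) genre);
* (ΔX) `γ_X(Ker aug_α) = Ker aug_β` ([AbsAnab] Lem. 1.3.8), (nX) `Δ^tp_C ⊄ Π^tp_X` ×2, (tf) no 2-torsion in `G_K`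
  (torsion-freeness of `G_{ℚ_p}`);
* (gen) the Kummer identification of the two cusp torsors with the genuine `H¹`-torsors (∃κ ×2);
* (μ) the induced `δ` carries `μ₂` to `μ₂`, and (b3) the canonical integral structures correspond — both stated for
  the class transport along `Γ ∘ Inn c` for every `c ∈ Π^tp_{Ċβ}`.
HONEST FRAMING: every input is a printed inference / cited or classical fact, none asserted; typed ≠ proved; no side
taken on [IUTchIII] Cor. 3.12.
-/

namespace Literature.AnabelianGeometry.EtaleTheta

open scoped Pointwise

section EndKnitXlevel

variable {p : ℕ} [Fact p.Prime] {Mα Mβ : MuTwoSetting p} {εα : Mα.GtpC} {εβ : Mβ.GtpC}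
  {hCα : Mα.toThetaSetting.Compat} {hCβ : Mβ.toThetaSetting.Compat}
  {Eα : Mα.toThetaSetting.EtaleThetaData} {Eβ : Mβ.toThetaSetting.EtaleThetaData}
  {γ : Mα.dotC εα ≃ₜ* Mβ.dotC εβ}

/-- **[EtTh] Thm. 1.10 (iii) (typed, ROW (C)) — the closer with the fully X-level residual.**
[cite: MochizukiEtTh2009, Thm 1.10 (iii) p.30] -/
theorem thm110iiiGalSect_of_Xlevel [T1Space Mα.GtpC] [T1Space Mβ.GtpC]
    (H : Thm110Hypothesis εα εβ hCα hCβ Eα Eβ γ)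
    (Sα : Mα.StandardData Eα.toKummerData) (Sβ : Mβ.StandardData Eβ.toKummerData)
    (Cα : Mα.DotCCusp εα) (Cβ : Mβ.DotCCusp εβ)
    [IsMulCommutative Cα.pair.I] [IsMulCommutative Cβ.pair.I]
    (hDα : IsClosed (Cα.pair.D : Set Mα.GtpC)) (hIα : IsCompact (Cα.pair.I : Set Mα.GtpC))
    (hDβ : IsClosed (Cβ.pair.D : Set Mβ.GtpC)) (hIβ : IsCompact (Cβ.pair.I : Set Mβ.GtpC))
    -- (law)
    (hcan : Cα.torsor.IsStructure (GalSect.unitsHat Mα.toThetaSetting.toTemperedCurve) Cα.canonical)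
    -- (x) + (ct)
    {σ : Mβ.PiTemp} (hσ : Mβ.inclX σ ∈ Mβ.dotC εβ)
    (hX : (MulAut.conj Cα.conj • Mα.decomp Cα.cusp).map H.γX.toMulEquiv.toMonoidHom =
      MulAut.conj σ • (MulAut.conj Cβ.conj • Mβ.decomp Cβ.cusp))
    (hCTα : ∀ g ∈ Mα.dotC εα, Subgroup.Commensurable (MulAut.conj g • Cα.pair.D) Cα.pair.D → g ∈ Cα.pair.D)
    (hCTβ : ∀ g ∈ Mβ.dotC εβ, Subgroup.Commensurable (MulAut.conj g • Cβ.pair.D) Cβ.pair.D → g ∈ Cβ.pair.D)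
    -- (ΔX) + (nX) + (tf)
    (hΔX : (Mα.aug.toMonoidHom.ker).map H.γX.toMulEquiv.toMonoidHom = Mβ.aug.toMonoidHom.ker)
    (hnα : ¬ Cα.augC.ker ≤ Mα.inclX.range) (hnβ : ¬ Cβ.augC.ker ≤ Mβ.inclX.range)
    (htf : ∀ x : Mβ.PiTemp, Mβ.aug x * Mβ.aug x = 1 → Mβ.aug x = 1)
    -- (gen)
    {S₀α : Subgroup Mα.GtpC} (hS₀α : S₀α ∈ Cα.pair.splittings)
    {S₀β : Subgroup Mβ.GtpC} (hS₀β : S₀β ∈ Cβ.pair.splittings)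
    (hgenα : haveI := Cα.pair.ID_normal
      ∃ κ : GalSect.KxHat Mα.toThetaSetting.toTemperedCurve ≃*
          ↥(ContH1.resKer Cα.pair.ID (⊤ : Subgroup Cα.pair.D)
            (Cα.pair.isClosedComplement_of_mem_splittings hS₀α).le_left),
        ∀ k cl, Cα.torsor.act k cl = (Cα.pair.torsorDataH1 hDα hIα hS₀α).act (κ k) cl)
    (hgenβ : haveI := Cβ.pair.ID_normal
      ∃ κ : GalSect.KxHat Mβ.toThetaSetting.toTemperedCurve ≃*
          ↥(ContH1.resKer Cβ.pair.ID (⊤ : Subgroup Cβ.pair.D)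
            (Cβ.pair.isClosedComplement_of_mem_splittings hS₀β).le_left),
        ∀ k cl, Cβ.torsor.act k cl = (Cβ.pair.torsorDataH1 hDβ hIβ hS₀β).act (κ k) cl)
    -- (μ), (b3) along `Γ ∘ Inn c` for every `c ∈ Π^tp_{Ċβ}`
    (hμ : ∀ c ∈ Mβ.dotC εβ,
      ∀ (δ : GalSect.KxHat Mα.toThetaSetting.toTemperedCurve →* GalSect.KxHat Mβ.toThetaSetting.toTemperedCurve)
        (e : Cα.pair.SplittingClass → Cβ.pair.SplittingClass),
      (∀ (S : Subgroup Mα.GtpC) (hS : S ∈ Cα.pair.splittings),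
        ∃ h', e (GalSect.CuspPair.SplittingClass.mk Cα.pair S hS) =
          GalSect.CuspPair.SplittingClass.mk Cβ.pair
            (S.map (H.Γ.trans (Mβ.innerAutC c)).toMulEquiv.toMonoidHom) h') →
      (∀ (k : GalSect.KxHat Mα.toThetaSetting.toTemperedCurve) (cl : Cα.pair.SplittingClass),
        e (Cα.torsor.act k cl) = Cβ.torsor.act (δ k) (e cl)) →
      Mα.muTwoHat.map δ = Mβ.muTwoHat)
    (hecan : ∀ c ∈ Mβ.dotC εβ, ∀ (e : Cα.pair.SplittingClass → Cβ.pair.SplittingClass),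
      (∀ (S : Subgroup Mα.GtpC) (hS : S ∈ Cα.pair.splittings),
        ∃ h', e (GalSect.CuspPair.SplittingClass.mk Cα.pair S hS) =
          GalSect.CuspPair.SplittingClass.mk Cβ.pair
            (S.map (H.Γ.trans (Mβ.innerAutC c)).toMulEquiv.toMonoidHom) h') →
      e '' Cα.canonical ⊆ Cβ.canonical) :
    Thm110iiiGalSect H Sα Sβ Cα Cβ :=
  thm110iiiGalSect_of_cuspDecompTransport H Sα Sβ Cα Cβ hDα hIα hDβ hIβ hcan hσ hX hCTα hCTβ
    (Cα.augC_ker_map_eq H Cβ hΔX hnα hnβ htf) hS₀α hS₀β hgenα hgenβ hμ hecan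

end EndKnitXlevel

end Literature.AnabelianGeometry.EtaleTheta
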